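import Summits.AtomisticToContinuum.Crystallization.Theorems.DisclinationRationBarlowLiouvilleStubCellsToPatches1
import Summits.AtomisticToContinuum.Crystallization.Theorems.ReggeStarCoercivityDefectFreeCrystallizesLayeredGluing

/-!
# `BarlowLiouville` (route `DisclinationRation`), stubs `stub_cellsToPatches` / `stub_rigidityCompactness`,
# part 2: exact cells from cells of every tolerance, and patches of a global rigid image

Support file (part 2 of 3) for item stmt-AtomisticToContinuum-15801 (crux
`Summit.AtomisticToContinuum.Crystallization.Theses.DisclinationRation.BarlowLiouville`, line
`Sketch`, rev 4), registered stubs `stub_cellsToPatches` / `stub_rigidityCompactness`; part 1 is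
`…StubCellsToPatches1` (vocabulary `CELL ς X y`, `PATCH R η X y` explained there, always inlined).
This part connects the line's inlined layered sets
`{A (i u(a) + j v(a) + L_s(m) w(a) + z(m) e₃)}` with the labelled templates `A (layeredPos a s z (m, i, j))`
of the sibling line `prestress-split-korn` (namespace `PrestressSplitKorn`: `layeredPos`, `InBox`,
`ExactNear`, and the landed EXACT LOCAL-TO-GLOBAL RIGIDITY of box templates
`exactLayeredRigidity_holds`), and proves:

* `rc_cell_rebase` — normal form of a cell at a point `w ∈ Y`: re-base the template at its point
  nearest the origin (`layeredPos_shift`; the family of relaxed layered sets is closed under re-basing at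
  any of its points), so that the cell reads `A (layeredPos a s z ·) + c`, `z 0 = 0`, `‖c‖ ≤ ς`;
* `rc_exactNear` — in a `δ`-separated `Y`, a point with `ς`-good cells for EVERY `ς > 0` is EXACTLY
  layered on its open `2`-ball (`ExactNear Y w`): compactness of the normalised data
  (`template_extraction`), finitely many labels can serve a given point (`label_bound`), and the OPEN
  ball makes "template point inside the ball" an open condition (pattern of `exactNear_of_limit`);
* `rc_patch_of_global` — if `0 ∈ Y = A (layeredPos a s z ·) − t` globally, then, after re-basing at
  the label of `0`, `Y` IS a set of the line's family, so `PATCH R η Y 0` for all `R` and `η ≥ 0`;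
* `rc_glob` — hence a `δ`-separated `Y ∋ 0` all of whose points have cells of every tolerance has
  `η`-good `R`-patches at `0` for all `(R, η)` (through `exactLayeredRigidity_holds`).

No definitions. [folklore] throughout (bookkeeping around the landed rigidity theorem).
-/

noncomputable section

namespace Summit.AtomisticToContinuum.Crystallization.Theorems.DisclinationRationBarlowLiouville

open Filter Topology Metric
open Literature.MathematicalPhysics.StatisticalMechanics Literature.Geometry.DiscreteGeometry
open Summit.AtomisticToContinuum.Crystallization.Theorems.PrestressSplitKorn
-- `E3 = EuclideanSpace ℝ (Fin 3)` as the (reducible) library abbreviation (no notation declared here).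
open Summit.AtomisticToContinuum.Crystallization.Theorems.ChargedEnergyGapNegative (E3)

/-! ## The line's layered sets are the labelled templates -/

/-- The inlined layered set of the line is the range of the labelled template `layeredPos`
(definitional unfolding). [folklore] -/
theorem rc_mem_layered_iff (A : E3 →ₗᵢ[ℝ] E3) (a : ℝ) (s : ℤ → ℤ) (z : ℤ → ℝ) (p : E3) :
    p ∈ {p : E3 | ∃ m i j : ℤ, p = A (((i : ℝ) • triangularVec₁ a) + ((j : ℝ) • triangularVec₂ a) +
      ((haggLabel s m : ℝ) • barlowOffset a) + (z m • layerNormal 1))} ↔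
      ∃ l : ℤ × ℤ × ℤ, p = A (layeredPos a s z l) := by
  constructor
  · rintro ⟨m, i, j, rfl⟩
    exact ⟨(m, i, j), rfl⟩
  · rintro ⟨⟨m, i, j⟩, rfl⟩
    exact ⟨m, i, j, rfl⟩

/-! ## Normal form of a cell -/

/-- NORMAL FORM OF A CELL at a point `w ∈ Y`: re-basing the template at its point nearest the origin
(`layeredPos_shift`, `InBox.shift`), a `ς`-good cell of `Y` at `w` reads: `Y − w` is two-way `ς`-matched
on the open `2`-ball with `A (layeredPos a s z ·) + c`, where `z 0 = 0` and `‖c‖ ≤ ς`. [folklore] -/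
theorem rc_cell_rebase {ς : ℝ} {Y : Set E3} {w : E3} (hw : w ∈ Y)
    (h : ∃ a : ℝ, 47 / 50 ≤ a ∧ a ≤ 1 ∧
      ∃ (A : E3 →ₗᵢ[ℝ] E3) (s : ℤ → ℤ) (z : ℤ → ℝ), IsHaggSeq s ∧
        (∀ m : ℤ, 39 / 50 * a ≤ z (m + 1) - z m ∧ z (m + 1) - z m ≤ 17 / 20 * a) ∧
        let S : Set E3 := {p | ∃ m i j : ℤ, p = A (((i : ℝ) • triangularVec₁ a) +
          ((j : ℝ) • triangularVec₂ a) + ((haggLabel s m : ℝ) • barlowOffset a) +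
          (z m • layerNormal 1))}
        (∀ p ∈ S, ‖p‖ < 2 → ∃ q ∈ Y, dist (q - w) p ≤ ς) ∧
        (∀ q ∈ Y, ‖q - w‖ < 2 → ∃ p ∈ S, dist (q - w) p ≤ ς)) :
    ∃ (A : E3 →ₗᵢ[ℝ] E3) (a : ℝ) (s : ℤ → ℤ) (z : ℤ → ℝ) (c : E3), InBox a z ∧ IsHaggSeq s ∧
      z 0 = 0 ∧ ‖c‖ ≤ ς ∧
      (∀ q ∈ Y, ‖q - w‖ < 2 → ∃ l, dist (q - w) (A (layeredPos a s z l) + c) ≤ ς) ∧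
      (∀ l, ‖A (layeredPos a s z l) + c‖ < 2 →
        ∃ q ∈ Y, dist (q - w) (A (layeredPos a s z l) + c) ≤ ς) := by
  obtain ⟨a, ha, ha1, A, s, z, hs, hz, h12⟩ := h
  dsimp only at h12
  obtain ⟨h1, h2⟩ := h12
  obtain ⟨p₀, hp₀, hd₀⟩ := h2 w hw (by rw [sub_self, norm_zero]; norm_num)
  obtain ⟨l₀, rfl⟩ := (rc_mem_layered_iff A a s z p₀).1 hp₀
  rw [sub_self, dist_comm, dist_zero_right] at hd₀
  have hbox : InBox a z := ⟨ha, ha1, hz⟩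
  have key : ∀ l, A (layeredPos a (fun k => s (k + l₀.1)) (fun k => z (k + l₀.1) - z l₀.1) l) +
      A (layeredPos a s z l₀) = A (layeredPos a s z (l + l₀)) := fun l => by
    rw [layeredPos_shift, map_sub, sub_add_cancel]
  refine ⟨A, a, fun k => s (k + l₀.1), fun k => z (k + l₀.1) - z l₀.1, A (layeredPos a s z l₀),
    hbox.shift _, isHaggSeq_shift hs _, by simp, hd₀, fun q hq hq2 => ?_, fun l hl => ?_⟩
  · obtain ⟨p, hp, hd⟩ := h2 q hq hq2
    obtain ⟨l, rfl⟩ := (rc_mem_layered_iff A a s z p).1 hp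
    refine ⟨l - l₀, ?_⟩
    rwa [key, sub_add_cancel]
  · rw [key] at hl ⊢
    exact h1 _ ((rc_mem_layered_iff A a s z _).2 ⟨l + l₀, rfl⟩) hl

/-! ## Exact cells from cells of every tolerance -/

/-- EXACT CELLS FROM CELLS OF EVERY TOLERANCE. In a `δ`-separated `Y`, a point `w` with `ς`-good cells
for every `ς > 0` is exactly layered on its open `2`-ball (`ExactNear Y w`, translation `t = -w`): the
normalised data of the `1/(n+1)`-cells (`rc_cell_rebase`) have a convergent subsequence
(`template_extraction`); a point `q ∈ Y` of the open ball is served, along the subsequence, by labels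
from a finite set (`label_bound`), hence by one label frequently, and is then the limit template point;
a limit template point strictly inside the ball is approximated by template points strictly inside
(open condition), which have `Y − w`-partners converging to it, and `Y − w` is locally finite
(`mem_of_forall_exists_dist_le`). [folklore] -/
theorem rc_exactNear {δ : ℝ} (hδ : 0 < δ) {Y : Set E3}
    (hYsep : ∀ p ∈ Y, ∀ q ∈ Y, p ≠ q → δ ≤ dist p q) {w : E3} (hw : w ∈ Y)
    (hcell : ∀ ς : ℝ, 0 < ς → ∃ a : ℝ, 47 / 50 ≤ a ∧ a ≤ 1 ∧
      ∃ (A : E3 →ₗᵢ[ℝ] E3) (s : ℤ → ℤ) (z : ℤ → ℝ), IsHaggSeq s ∧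
        (∀ m : ℤ, 39 / 50 * a ≤ z (m + 1) - z m ∧ z (m + 1) - z m ≤ 17 / 20 * a) ∧
        let S : Set E3 := {p | ∃ m i j : ℤ, p = A (((i : ℝ) • triangularVec₁ a) +
          ((j : ℝ) • triangularVec₂ a) + ((haggLabel s m : ℝ) • barlowOffset a) +
          (z m • layerNormal 1))}
        (∀ p ∈ S, ‖p‖ < 2 → ∃ q ∈ Y, dist (q - w) p ≤ ς) ∧
        (∀ q ∈ Y, ‖q - w‖ < 2 → ∃ p ∈ S, dist (q - w) p ≤ ς)) :
    ExactNear Y w := by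
  have hfin : ∀ v : E3, (Y ∩ closedBall v 1).Finite := fun v =>
    finite_of_forall_le_dist_of_subset_closedBall hδ (fun p hp q hq => hYsep p hp.1 q hq.1)
      Set.inter_subset_right
  -- normalised data of the `1/(n+1)`-cells
  have hdata := fun n : ℕ => rc_cell_rebase hw (hcell (1 / ((n : ℝ) + 1)) (by positivity))
  choose A a s z c hbox hs hz0 hc h1 h2 using hdata
  -- extraction of convergent data
  obtain ⟨ψ, A', -, a', s', z', hψ, hbox', hs', -, hA', -, ha', hs'ev, hz'⟩ :=
    template_extraction A (fun _ => 0) a s z (C := 0)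
      (Eventually.of_forall fun n => ⟨hbox n, hs n, hz0 n, by rw [norm_zero]⟩)
  have hψt : Tendsto ψ atTop atTop := hψ.tendsto_atTop
  have hςψ : Tendsto (fun k : ℕ => 1 / (((ψ k : ℕ) : ℝ) + 1)) atTop (𝓝 0) :=
    (tendsto_one_div_add_atTop_nhds_zero_nat (𝕜 := ℝ)).comp hψt
  have hcψ : Tendsto (fun k => c (ψ k)) atTop (𝓝 0) := squeeze_zero_norm (fun k => hc (ψ k)) hςψ
  have hTP : ∀ l, Tendsto (fun k => A (ψ k) (layeredPos (a (ψ k)) (s (ψ k)) (z (ψ k)) l) + c (ψ k))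
      atTop (𝓝 (A' (layeredPos a' s' z' l))) := fun l => by
    have := (tendsto_isometry_apply hA' (tendsto_layeredPos ha' hs'ev hz' l)).add hcψ
    rwa [add_zero] at this
  have hς1 : ∀ k : ℕ, 1 / (((ψ k : ℕ) : ℝ) + 1) ≤ 1 := fun k => by
    rw [div_le_one (by positivity)]
    linarith [(ψ k).cast_nonneg (α := ℝ)]
  refine ⟨A', -w, a', s', z', hbox', hs', fun y hy hyw => ?_, fun l hl => ?_⟩
  · -- clause 1: a point of `Y` in the open ball is a limit template point
    rw [dist_eq_norm] at hyw
    set B : ℤ := ⌈4 * (4 : ℝ)⌉ with hB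
    set F : Finset (ℤ × ℤ × ℤ) := (Finset.Icc (-B) B) ×ˢ ((Finset.Icc (-B) B) ×ˢ (Finset.Icc (-B) B))
      with hF
    have hIcc : ∀ n : ℤ, |(n : ℝ)| ≤ 4 * 4 → n ∈ Finset.Icc (-B) B := fun n hn => by
      rw [Finset.mem_Icc]
      obtain ⟨hn1, hn2⟩ := abs_le.1 hn
      have hB' : 4 * (4 : ℝ) ≤ (B : ℝ) := Int.le_ceil _
      constructor
      · have : (-B : ℝ) ≤ n := by linarith
        exact_mod_cast this
      · have : (n : ℝ) ≤ B := by linarith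
        exact_mod_cast this
    have hFall : ∃ᶠ k in atTop, ∃ l ∈ F, dist (y - w)
        (A (ψ k) (layeredPos (a (ψ k)) (s (ψ k)) (z (ψ k)) l) + c (ψ k)) ≤ 1 / (((ψ k : ℕ) : ℝ) + 1) := by
      refine (Eventually.of_forall fun k => ?_).frequently
      obtain ⟨l, hl⟩ := h1 (ψ k) y hy hyw
      refine ⟨l, ?_, hl⟩
      have hnorm : ‖layeredPos (a (ψ k)) (s (ψ k)) (z (ψ k)) l‖ ≤ 4 := by
        rw [← (A (ψ k)).norm_map]
        have h3 := norm_add_le (A (ψ k) (layeredPos (a (ψ k)) (s (ψ k)) (z (ψ k)) l) + c (ψ k))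
          (-(c (ψ k)))
        rw [add_neg_cancel_right, norm_neg] at h3
        have h4 := norm_add_le (A (ψ k) (layeredPos (a (ψ k)) (s (ψ k)) (z (ψ k)) l) + c (ψ k) - (y - w))
          (y - w)
        rw [sub_add_cancel, ← dist_eq_norm, dist_comm] at h4
        linarith [hc (ψ k), hς1 k]
      obtain ⟨hm, hi, hj⟩ := label_bound (hbox (ψ k)) (hs (ψ k)) (hz0 (ψ k)) l hnorm
      simp only [hF, Finset.mem_product]
      exact ⟨hIcc _ hm, hIcc _ hi, hIcc _ hj⟩
    obtain ⟨l, -, hl⟩ := exists_frequently_of_frequently_exists F hFall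
    refine ⟨l, ?_⟩
    have hD := le_zero_of_frequently_le (tendsto_const_nhds.dist (hTP l)) hςψ hl
    rw [← sub_eq_add_neg]
    exact dist_le_zero.1 hD
  · -- clause 2: a limit template point strictly inside the ball is a point of `Y − w`
    rw [add_neg_cancel, dist_zero_right] at hl
    rw [sub_neg_eq_add]
    have h2' : ∀ᶠ k in atTop,
        ‖A (ψ k) (layeredPos (a (ψ k)) (s (ψ k)) (z (ψ k)) l) + c (ψ k)‖ < 2 :=
      (hTP l).norm.eventually (gt_mem_nhds hl)
    apply mem_of_forall_exists_dist_le (hfin _)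
    intro γ hγ
    have hsmall : ∀ᶠ k in atTop, dist (A (ψ k) (layeredPos (a (ψ k)) (s (ψ k)) (z (ψ k)) l) + c (ψ k))
        (A' (layeredPos a' s' z' l)) < γ / 2 :=
      Metric.tendsto_nhds.1 (hTP l) _ (half_pos hγ)
    have hςγ : ∀ᶠ k : ℕ in atTop, 1 / (((ψ k : ℕ) : ℝ) + 1) < γ / 2 :=
      hςψ.eventually (gt_mem_nhds (half_pos hγ))
    obtain ⟨k, hk2, hks, hkς⟩ := (h2'.and (hsmall.and hςγ)).exists
    obtain ⟨q, hq, hd⟩ := h2 (ψ k) l hk2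
    refine ⟨q, hq, ?_⟩
    calc dist q (A' (layeredPos a' s' z' l) + w)
        = dist (q - w) (A' (layeredPos a' s' z' l)) := by
          rw [← dist_sub_right q _ w, add_sub_cancel_right]
      _ ≤ dist (q - w) (A (ψ k) (layeredPos (a (ψ k)) (s (ψ k)) (z (ψ k)) l) + c (ψ k)) +
          dist (A (ψ k) (layeredPos (a (ψ k)) (s (ψ k)) (z (ψ k)) l) + c (ψ k))
            (A' (layeredPos a' s' z' l)) := dist_triangle _ _ _
      _ ≤ γ := by linarith

/-! ## Patches of a global rigid image -/

/-- PATCHES OF A GLOBAL RIGID IMAGE. If `0 ∈ Y` and `Y = A (layeredPos a s z ·) − t` globally (box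
data), then re-basing the template at the label of `0` (`layeredPos_shift`, `InBox.shift`) exhibits `Y`
as a set `{A (i u(a) + j v(a) + L_{s'}(m) w(a) + z'(m) e₃)}` of the line's family, so `Y` has
`η`-good `R`-patches at `0` for every `R` and every `η ≥ 0`. [folklore] -/
theorem rc_patch_of_global {Y : Set E3} (h0 : (0 : E3) ∈ Y) {A : E3 →ₗᵢ[ℝ] E3} {t : E3} {a : ℝ}
    {s : ℤ → ℤ} {z : ℤ → ℝ} (hbox : InBox a z) (hs : IsHaggSeq s)
    (hY : Y = {y | ∃ l, y + t = A (layeredPos a s z l)}) (R η : ℝ) (hη : 0 ≤ η) :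
    ∃ a : ℝ, 47 / 50 ≤ a ∧ a ≤ 1 ∧
      ∃ (A : E3 →ₗᵢ[ℝ] E3) (s : ℤ → ℤ) (z : ℤ → ℝ), IsHaggSeq s ∧
        (∀ m : ℤ, 39 / 50 * a ≤ z (m + 1) - z m ∧ z (m + 1) - z m ≤ 17 / 20 * a) ∧
        let S : Set E3 := {p | ∃ m i j : ℤ, p = A (((i : ℝ) • triangularVec₁ a) +
          ((j : ℝ) • triangularVec₂ a) + ((haggLabel s m : ℝ) • barlowOffset a) +
          (z m • layerNormal 1))}
        (∀ p ∈ S, ‖p‖ ≤ R → ∃ q ∈ Y, dist (q - 0) p ≤ η) ∧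
        (∀ q ∈ Y, ‖q - 0‖ ≤ R → ∃ p ∈ S, dist (q - 0) p ≤ η) := by
  have h0' := h0
  rw [hY] at h0'
  obtain ⟨l₀, hl₀⟩ := h0'
  rw [zero_add] at hl₀
  have key : ∀ l, A (layeredPos a (fun k => s (k + l₀.1)) (fun k => z (k + l₀.1) - z l₀.1) l) =
      A (layeredPos a s z (l + l₀)) - t := fun l => by
    rw [hl₀, layeredPos_shift, map_sub]
  have hmem : ∀ l, A (layeredPos a (fun k => s (k + l₀.1)) (fun k => z (k + l₀.1) - z l₀.1) l) ∈ Y :=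
    fun l => by
    rw [hY]
    exact ⟨l + l₀, by rw [key, sub_add_cancel]⟩
  have hmem' : ∀ y ∈ Y, ∃ l,
      y = A (layeredPos a (fun k => s (k + l₀.1)) (fun k => z (k + l₀.1) - z l₀.1) l) := by
    intro y hy
    rw [hY] at hy
    obtain ⟨l, hl⟩ := hy
    exact ⟨l - l₀, by rw [key, sub_add_cancel, ← hl, add_sub_cancel_right]⟩
  refine ⟨a, hbox.1, hbox.2.1, A, fun k => s (k + l₀.1), fun k => z (k + l₀.1) - z l₀.1,
    isHaggSeq_shift hs _, (hbox.shift _).2.2, ?_⟩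
  dsimp only
  refine ⟨fun p hp _ => ?_, fun q hq _ => ?_⟩
  · obtain ⟨l, rfl⟩ := (rc_mem_layered_iff A a _ _ p).1 hp
    exact ⟨_, hmem l, by rwa [sub_zero, dist_self]⟩
  · obtain ⟨l, rfl⟩ := hmem' q hq
    exact ⟨_, (rc_mem_layered_iff A a _ _ _).2 ⟨l, rfl⟩, by rwa [sub_zero, dist_self]⟩

/-- CELLS OF EVERY TOLERANCE EVERYWHERE GIVE PATCHES OF EVERY SIZE: a `δ`-separated `Y ∋ 0` all of whose
points have `ς`-good cells for every `ς > 0` is exactly layered on every open `2`-ball (`rc_exactNear`),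
hence globally one rigid image of one box template (`exactLayeredRigidity_holds`, the landed exact
local-to-global rigidity of the sibling line `prestress-split-korn`), hence has `η`-good `R`-patches at
`0` for all `R` and `η > 0` (`rc_patch_of_global`). [folklore] -/
theorem rc_glob : ∀ δ : ℝ, 0 < δ → ∀ Y : Set E3, (∀ p ∈ Y, ∀ q ∈ Y, p ≠ q → δ ≤ dist p q) →
    (0 : E3) ∈ Y →
    (∀ w ∈ Y, ∀ ς : ℝ, 0 < ς → ∃ a : ℝ, 47 / 50 ≤ a ∧ a ≤ 1 ∧
      ∃ (A : E3 →ₗᵢ[ℝ] E3) (s : ℤ → ℤ) (z : ℤ → ℝ), IsHaggSeq s ∧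
        (∀ m : ℤ, 39 / 50 * a ≤ z (m + 1) - z m ∧ z (m + 1) - z m ≤ 17 / 20 * a) ∧
        let S : Set E3 := {p | ∃ m i j : ℤ, p = A (((i : ℝ) • triangularVec₁ a) +
          ((j : ℝ) • triangularVec₂ a) + ((haggLabel s m : ℝ) • barlowOffset a) +
          (z m • layerNormal 1))}
        (∀ p ∈ S, ‖p‖ < 2 → ∃ q ∈ Y, dist (q - w) p ≤ ς) ∧
        (∀ q ∈ Y, ‖q - w‖ < 2 → ∃ p ∈ S, dist (q - w) p ≤ ς)) →
    ∀ R η : ℝ, 0 < η → ∃ a : ℝ, 47 / 50 ≤ a ∧ a ≤ 1 ∧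
      ∃ (A : E3 →ₗᵢ[ℝ] E3) (s : ℤ → ℤ) (z : ℤ → ℝ), IsHaggSeq s ∧
        (∀ m : ℤ, 39 / 50 * a ≤ z (m + 1) - z m ∧ z (m + 1) - z m ≤ 17 / 20 * a) ∧
        let S : Set E3 := {p | ∃ m i j : ℤ, p = A (((i : ℝ) • triangularVec₁ a) +
          ((j : ℝ) • triangularVec₂ a) + ((haggLabel s m : ℝ) • barlowOffset a) +
          (z m • layerNormal 1))}
        (∀ p ∈ S, ‖p‖ ≤ R → ∃ q ∈ Y, dist (q - 0) p ≤ η) ∧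
        (∀ q ∈ Y, ‖q - 0‖ ≤ R → ∃ p ∈ S, dist (q - 0) p ≤ η) := by
  intro δ hδ Y hYsep h0 hcell R η hη
  have hex : ∀ w ∈ Y, ExactNear Y w := fun w hw => rc_exactNear hδ hYsep hw (hcell w hw)
  obtain ⟨A, t, a, s, z, hbox, hs, hY⟩ := exactLayeredRigidity_holds Y ⟨0, h0⟩ ⟨δ, hδ, hYsep⟩ hex
  exact rc_patch_of_global h0 hbox hs hY R η hη.le

end Summit.AtomisticToContinuum.Crystallization.Theorems.DisclinationRationBarlowLiouville

end
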